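import Literature.Computability.AlgebraicComplexity.LaserComponentTools
import HarnessLib

/-!
# The recursion of the laser method on products `t ⊗ t'` (Le Gall 2014, §5) and the matrix
components of a product (Le Gall 2014, Lemma 6.1) — proved

Topic `Literature/Computability/AlgebraicComplexity`.  Le Gall, *Powers of tensors and fast matrix
multiplication* (ISSAC 2014, arXiv:1401.7714), §5, iterates the laser method on a product of two
tensors with decompositions of tight supports:

> Consider the following decomposition of `t ⊗ t′`: the support is
> `supp(t ⊗ t′) = {(α₁(s)+α₁(s′), α₂(s)+α₂(s′), α₃(s)+α₃(s′)) | s ∈ supp(t), s′ ∈ supp(t′)}` and, for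
> each `(a,b,c) ∈ supp(t ⊗ t′)` the associated component is `(t ⊗ t′)(a,b,c) = ∑ t(s) ⊗ t′(s′)`, where
> the sum is over all `(s,s′)` such that `α₁(s)+α₁(s′) = a`, `α₂(s)+α₂(s′) = b` and
> `α₃(s)+α₃(s′) = c`. Note that the support of this decomposition is tight. … For any `(a,b,c)`,
> consider the following decomposition of `(t ⊗ t′)(a,b,c)`: the support is
> `{s ∈ supp(t) | (a−α₁(s), b−α₂(s), c−α₃(s)) ∈ supp(t′)}` and, for each element `s` in this set,
> the corresponding component is `t(s) ⊗ t′(a−α₁(s), b−α₂(s), c−α₃(s))`. Note that the support in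
> this decomposition is tight … The value of each component can be lower bounded as
> `V_ρ(t(s) ⊗ t′(…)) ≥ V_ρ(t(s)) × V_ρ(t′(…))`, from the supermultiplicativity of the value. … we
> can use [Theorem 4.1] on each `(t ⊗ t′)(a,b,c)` to obtain a lower bound on `V_ρ((t ⊗ t′)(a,b,c))`.

This file PROVES that recursion step in the tree's coordinates, for tensors `t`, `t'` whose three
slots carry labels in `{0,…,B}` (resp. `{0,…,B'}`) adding up to a constant weight `w` (resp. `w'`)
on the support — the shape of every power of the Coppersmith–Winograd tensor:

* `addLab`, `pairLab`, `sumLab` — the pair of labels `(α(x), α′(x′))` and their sum; `sumLab_weight`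
  — the sum labels of `t ⊗ t′` add up to `w + w′` on its support (the decomposition of `t ⊗ t′`);
* `prodComp t t' a b c` — the component `(t ⊗ t′)(a,b,c)`; `pairSupp` — the labels
  `((i,i′),(j,j′),(l,l′))` with `i+j+l = w`, `i′+j′+l′ = w′`, `i+i′ = a`, `j+j′ = b`, `l+l′ = c` (Le
  Gall's `S_{abc}`); `prodComp_pairSupp` — they carry the pair decomposition of `(t ⊗ t′)(a,b,c)`;
  `prodComp_pair` — **its `((i,i′),(j,j′),(l,l′))`-component is `t(i,j,l) ⊗ t′(i′,j′,l′)`** (or `0`);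
  `pairTight`, `pairTightγ` and their lemmas — the pair decomposition is tight;
* `hasLaserValue_symm3_prodComp` — **the recursion step**: from Le Gall values `V(s)`, `V′(s′)` of the
  components of `t`, `t′` and ANY probability distribution `P` on a set `S ⊆ S_{abc}` carrying the
  pair decomposition,
  `V_ρ((t ⊗ t′)(a,b,c))³ ≥ 2^{H(P₁)+H(P₂)+H(P₃) − 3Γ_S(P)} ∏_{s ∈ S} (V(s₁) V′(s₂))^{P(s)}`
  (Le Gall's Theorem 4.1 `laserMethodSym_hasLaserValue` on the pair decomposition, with the values
  of the pair components bounded by supermultiplicativity `HasLaserValue.symm3_kronecker`).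

and the analytic bound for the components with a zero label (Le Gall, Lemma 6.1: "we do not need to
apply [the laser method] when `a = 0`, `b = 0` or `c = 0`, since a lower bound on the value can be
found analytically"; Stothers 2010, Claim 7), in the following general form.  Say the `x₀`-slice of
`t` is a **unit slice** (`IsUnitSlice t x₀ A φ`) if `t(x₀, y, z) = [y ∈ A ∧ z = φ(y)]` with `φ`
injective on `A` — the slice is the tensor of `⟨1, |A|, 1⟩`.  PROVED: unit slices are preserved by
Kronecker products (`IsUnitSlice.kronecker`, with `A × A′`) and by zero-outs keeping `x₀`
(`IsUnitSlice.partSubtensor`, with the sub-family of `A` kept), a tensor with a unit slice has Le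
Gall value `≥ |A|^{ρ/3}` (`IsUnitSlice.hasLaserValue_symm3`), and the counting identity behind the
polynomials of Lemma 6.1, `|{(x,x′) | g(x) + g′(x′) = n}| = ∑_{i ≤ n} |{g = i}| · |{g′ = n−i}|`
(`card_filter_add_eq_sum`).

Everything is proved; no named facts.  The application to `CW_q^{⊗4}` (Le Gall Table 3, `ω < 2.373`)
is carried out in the `BigCwFourth*` files.

## References

* F. Le Gall, *Powers of tensors and fast matrix multiplication*, ISSAC 2014, arXiv:1401.7714
  (held: `paper:arxiv-1401.7714`): §5 (pp. 9–11), Lemma 6.1 (p. 13). [LeGall2014]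
* A. J. Stothers, *On the complexity of matrix multiplication*, PhD thesis, Edinburgh 2010, Claim 7.
* V. Vassilevska Williams, *Multiplying matrices faster than Coppersmith–Winograd*, STOC 2012, §3.
-/

noncomputable section

open scoped BigOperators
open Finset

namespace Literature.Computability.AlgebraicComplexity

universe u

/-! ## Pair labels and sum labels -/

section Labels

variable {B B' : ℕ}

/-- The sum of a pair of bounded labels, `(i, i′) ↦ i + i′ ∈ {0, …, B + B′}`. [cite: LeGall2014, §5 (p. 9)] -/
def addLab (p : Fin (B + 1) × Fin (B' + 1)) : Fin (B + B' + 1) :=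
  ⟨p.1 + p.2, by have := p.1.isLt; have := p.2.isLt; omega⟩

/-- `addLab` as a natural number. [folklore] -/
@[simp] theorem coe_addLab (p : Fin (B + 1) × Fin (B' + 1)) : (addLab p : ℕ) = p.1 + p.2 := rfl

variable {X X' : Type*}

/-- **Pair labels** of the indices of `t ⊗ t′`: `(x, x′) ↦ (α(x), α′(x′))` (Le Gall §5: the
decomposition of a component of `t ⊗ t′` "by `s`", equivalently by the pair `(s, s′)`).
[cite: LeGall2014, §5 (p. 10)] -/
abbrev pairLab (pX : X → Fin (B + 1)) (pX' : X' → Fin (B' + 1)) (x : X × X') :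
    Fin (B + 1) × Fin (B' + 1) :=
  (pX x.1, pX' x.2)

/-- **Sum labels** of the indices of `t ⊗ t′`: `(x, x′) ↦ α(x) + α′(x′)` (Le Gall §5: "the support is
`{(α₁(s)+α₁(s′), …)}`"). [cite: LeGall2014, §5 (p. 9)] -/
abbrev sumLab (pX : X → Fin (B + 1)) (pX' : X' → Fin (B' + 1)) (x : X × X') : Fin (B + B' + 1) :=
  addLab (pairLab pX pX' x)

end Labels

/-! ## The decomposition of `t ⊗ t′` and of its components -/

section Decomposition

variable {K : Type u} [CommSemiring K]
variable {X Y Z X' Y' Z' : Type*} {B B' : ℕ}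
variable (pX : X → Fin (B + 1)) (pY : Y → Fin (B + 1)) (pZ : Z → Fin (B + 1))
variable (pX' : X' → Fin (B' + 1)) (pY' : Y' → Fin (B' + 1)) (pZ' : Z' → Fin (B' + 1))

/-- **The decomposition of `t ⊗ t′` by sum labels has constant weight `w + w′`** when those of `t`,
`t′` have weights `w`, `w′` (so its support is tight whenever it is finite).
[cite: LeGall2014, §5 (p. 9–10)] -/
theorem sumLab_weight {t : X → Y → Z → K} {t' : X' → Y' → Z' → K} {w w' : ℕ}
    (ht : ∀ x y z, t x y z ≠ 0 → (pX x : ℕ) + pY y + pZ z = w)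
    (ht' : ∀ x y z, t' x y z ≠ 0 → (pX' x : ℕ) + pY' y + pZ' z = w')
    (x : X × X') (y : Y × Y') (z : Z × Z') (h : kroneckerTensor t t' x y z ≠ 0) :
    (sumLab pX pX' x : ℕ) + sumLab pY pY' y + sumLab pZ pZ' z = w + w' := by
  rw [kroneckerTensor_apply] at h
  have h1 := ht _ _ _ (left_ne_zero_of_mul h)
  have h2 := ht' _ _ _ (right_ne_zero_of_mul h)
  simp only [coe_addLab]
  omega

variable (B B') in
/-- **Le Gall's `S_{abc}`**: the pair labels `((i,i′),(j,j′),(l,l′))` with `i+j+l = w`,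
`i′+j′+l′ = w′` and sums `(a,b,c)` ("`{s ∈ supp(t) | (a−α₁(s), b−α₂(s), c−α₃(s)) ∈ supp(t′)}`").
[cite: LeGall2014, §5 (p. 10)] -/
def pairSupp (w w' a b c : ℕ) :
    Finset ((Fin (B + 1) × Fin (B' + 1)) × (Fin (B + 1) × Fin (B' + 1)) ×
      (Fin (B + 1) × Fin (B' + 1))) :=
  Finset.univ.filter fun s => (s.1.1 : ℕ) + s.2.1.1 + s.2.2.1 = w ∧
    (s.1.2 : ℕ) + s.2.1.2 + s.2.2.2 = w' ∧ (s.1.1 : ℕ) + s.1.2 = a ∧ (s.2.1.1 : ℕ) + s.2.1.2 = b ∧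
      (s.2.2.1 : ℕ) + s.2.2.2 = c

/-- Membership in `S_{abc}`. [folklore] -/
theorem mem_pairSupp {w w' a b c : ℕ}
    {s : (Fin (B + 1) × Fin (B' + 1)) × (Fin (B + 1) × Fin (B' + 1)) ×
      (Fin (B + 1) × Fin (B' + 1))} :
    s ∈ pairSupp B B' w w' a b c ↔ (s.1.1 : ℕ) + s.2.1.1 + s.2.2.1 = w ∧
      (s.1.2 : ℕ) + s.2.1.2 + s.2.2.2 = w' ∧ (s.1.1 : ℕ) + s.1.2 = a ∧ (s.2.1.1 : ℕ) + s.2.1.2 = b ∧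
        (s.2.2.1 : ℕ) + s.2.2.2 = c := by
  simp [pairSupp]

/-- **The component `(t ⊗ t′)(a,b,c)`** of the decomposition of `t ⊗ t′` by sum labels.
[cite: LeGall2014, §5 (p. 10)] -/
abbrev prodComp (t : X → Y → Z → K) (t' : X' → Y' → Z' → K) (a b c : Fin (B + B' + 1)) :
    X × X' → Y × Y' → Z × Z' → K :=
  partSubtensor (sumLab pX pX') (sumLab pY pY') (sumLab pZ pZ') (kroneckerTensor t t') {a} {b} {c}

/-- **The pair labels of the support of `(t ⊗ t′)(a,b,c)` lie in `S_{abc}`.** [cite: LeGall2014, §5 (p. 10)] -/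
theorem prodComp_pairSupp {t : X → Y → Z → K} {t' : X' → Y' → Z' → K} {w w' : ℕ}
    (ht : ∀ x y z, t x y z ≠ 0 → (pX x : ℕ) + pY y + pZ z = w)
    (ht' : ∀ x y z, t' x y z ≠ 0 → (pX' x : ℕ) + pY' y + pZ' z = w') (a b c : Fin (B + B' + 1))
    (x : X × X') (y : Y × Y') (z : Z × Z')
    (h : prodComp pX pY pZ pX' pY' pZ' t t' a b c x y z ≠ 0) :
    (pairLab pX pX' x, pairLab pY pY' y, pairLab pZ pZ' z) ∈ pairSupp B B' w w' a b c := by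
  have h' : (if sumLab pX pX' x ∈ ({a} : Finset _) ∧ sumLab pY pY' y ∈ ({b} : Finset _) ∧
      sumLab pZ pZ' z ∈ ({c} : Finset _) then kroneckerTensor t t' x y z else 0) ≠ 0 := h
  clear h
  split_ifs at h' with hc
  · simp only [Finset.mem_singleton] at hc
    obtain ⟨hx, hy, hz⟩ := hc
    have ex := congrArg Fin.val hx
    have ey := congrArg Fin.val hy
    have ez := congrArg Fin.val hz
    simp only [coe_addLab] at ex ey ez
    rw [kroneckerTensor_apply] at h'
    have h1 := ht _ _ _ (left_ne_zero_of_mul h')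
    have h2 := ht' _ _ _ (right_ne_zero_of_mul h')
    rw [mem_pairSupp]
    dsimp only
    omega
  · exact absurd rfl h'

/-- **The pair components of `(t ⊗ t′)(a,b,c)` are the products `t(i,j,l) ⊗ t′(i′,j′,l′)`** with
`i+i′ = a`, `j+j′ = b`, `l+l′ = c` (and `0` for other pairs). [cite: LeGall2014, §5 (p. 10)] -/
theorem prodComp_pair (t : X → Y → Z → K) (t' : X' → Y' → Z' → K) (a b c : Fin (B + B' + 1))
    (p q r : Fin (B + 1) × Fin (B' + 1)) :
    partSubtensor (pairLab pX pX') (pairLab pY pY') (pairLab pZ pZ')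
        (prodComp pX pY pZ pX' pY' pZ' t t' a b c) {p} {q} {r} =
      if addLab p = a ∧ addLab q = b ∧ addLab r = c then
        kroneckerTensor (partSubtensor pX pY pZ t {p.1} {q.1} {r.1})
          (partSubtensor pX' pY' pZ' t' {p.2} {q.2} {r.2}) else 0 := by
  obtain ⟨i, i'⟩ := p
  obtain ⟨j, j'⟩ := q
  obtain ⟨l, l'⟩ := r
  rw [show prodComp pX pY pZ pX' pY' pZ' t t' a b c =
      partSubtensor (fun x => addLab (pairLab pX pX' x)) (fun y => addLab (pairLab pY pY' y))
        (fun z => addLab (pairLab pZ pZ' z)) (kroneckerTensor t t') {a} {b} {c} from rfl,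
    partSubtensor_partSubtensor_singleton]
  congr 1
  exact partSubtensor_kronecker pX pY pZ pX' pY' pZ' t t' i j l i' j' l'

end Decomposition

/-! ## Tightness of the pair decomposition -/

section Tight

variable {B B' : ℕ}

/-- Tightness vectors of the pair labels in the first two slots: the pair itself. [cite: LeGall2014, §5 (p. 10: "the support in this decomposition is tight")] -/
def pairTight (p : Fin (B + 1) × Fin (B' + 1)) : Fin 2 → ℤ := ![((p.1 : ℕ) : ℤ), ((p.2 : ℕ) : ℤ)]

/-- Tightness vectors in the third slot: the pair minus the weights `(w, w′)`. [cite: LeGall2014, §5 (p. 10)] -/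
def pairTightγ (w w' : ℕ) (p : Fin (B + 1) × Fin (B' + 1)) : Fin 2 → ℤ :=
  ![((p.1 : ℕ) : ℤ) - w, ((p.2 : ℕ) : ℤ) - w']

/-- `pairTight` is injective. [folklore] -/
theorem pairTight_injective :
    Function.Injective (pairTight : Fin (B + 1) × Fin (B' + 1) → Fin 2 → ℤ) := by
  intro p p' h
  have h0 := congrFun h 0
  have h1 := congrFun h 1
  simp only [pairTight, Matrix.cons_val_zero, Matrix.cons_val_one, Nat.cast_inj] at h0 h1
  exact Prod.ext (Fin.ext h0) (Fin.ext h1)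

/-- `pairTightγ w w′` is injective. [folklore] -/
theorem pairTightγ_injective (w w' : ℕ) :
    Function.Injective (pairTightγ w w' : Fin (B + 1) × Fin (B' + 1) → Fin 2 → ℤ) := by
  intro p p' h
  have h0 := congrFun h 0
  have h1 := congrFun h 1
  simp only [pairTightγ, Matrix.cons_val_zero, Matrix.cons_val_one, sub_left_inj,
    Nat.cast_inj] at h0 h1
  exact Prod.ext (Fin.ext h0) (Fin.ext h1)

/-- `|pairTight p| ≤ B + B′ + w + w′`. [folklore] -/
theorem pairTight_bound (w w' : ℕ) (p : Fin (B + 1) × Fin (B' + 1)) (k : Fin 2) :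
    |pairTight p k| ≤ (B + B' + w + w' : ℕ) := by
  have h1 := p.1.isLt
  have h2 := p.2.isLt
  fin_cases k
  · simp only [pairTight, Fin.zero_eta, Matrix.cons_val_zero]
    rw [abs_le]; constructor <;> push_cast <;> omega
  · simp only [pairTight, Fin.mk_one, Matrix.cons_val_one, Matrix.cons_val_fin_one]
    rw [abs_le]; constructor <;> push_cast <;> omega

/-- `|pairTightγ w w′ p| ≤ B + B′ + w + w′`. [folklore] -/
theorem pairTightγ_bound (w w' : ℕ) (p : Fin (B + 1) × Fin (B' + 1)) (k : Fin 2) :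
    |pairTightγ w w' p k| ≤ (B + B' + w + w' : ℕ) := by
  have h1 := p.1.isLt
  have h2 := p.2.isLt
  fin_cases k
  · simp only [pairTightγ, Fin.zero_eta, Matrix.cons_val_zero]
    rw [abs_le]; constructor <;> push_cast <;> omega
  · simp only [pairTightγ, Fin.mk_one, Matrix.cons_val_one, Matrix.cons_val_fin_one]
    rw [abs_le]; constructor <;> push_cast <;> omega

/-- **The pair decomposition is tight**: on `S_{abc}` the tightness vectors add up to `0`.
[cite: LeGall2014, §5 (p. 10)] -/
theorem pairTight_sum {w w' a b c : ℕ}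
    (s : (Fin (B + 1) × Fin (B' + 1)) × (Fin (B + 1) × Fin (B' + 1)) ×
      (Fin (B + 1) × Fin (B' + 1))) (hs : s ∈ pairSupp B B' w w' a b c) (k : Fin 2) :
    pairTight s.1 k + pairTight s.2.1 k + pairTightγ w w' s.2.2 k = 0 := by
  rw [mem_pairSupp] at hs
  fin_cases k
  · simp only [pairTight, pairTightγ, Fin.zero_eta, Matrix.cons_val_zero]
    omega
  · simp only [pairTight, pairTightγ, Fin.mk_one, Matrix.cons_val_one, Matrix.cons_val_fin_one]
    omega

end Tight

/-! ## The recursion step -/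

section Recursion

variable {K : Type u} [Field K]
variable {X Y Z X' Y' Z' : Type*} [Fintype X] [Fintype Y] [Fintype Z] [Fintype X'] [Fintype Y']
  [Fintype Z'] [DecidableEq X] [DecidableEq Y] [DecidableEq Z] [DecidableEq X'] [DecidableEq Y']
  [DecidableEq Z']
variable {B B' : ℕ}
variable (pX : X → Fin (B + 1)) (pY : Y → Fin (B + 1)) (pZ : Z → Fin (B + 1))
variable (pX' : X' → Fin (B' + 1)) (pY' : Y' → Fin (B' + 1)) (pZ' : Z' → Fin (B' + 1))

/-- **Le Gall 2014, §5 — the recursion step of the laser method on `t ⊗ t′`.**  Let the slots of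
`t` (resp. `t′`) carry labels in `{0,…,B}` (resp. `{0,…,B′}`) of constant weight `w` (resp. `w′`)
on the support, and let `V(i,j,l) > 0` (resp. `V′`) be such that
`V_ρ(t(i,j,l) ⊗ t(i,j,l)_C ⊗ t(i,j,l)_{C²}) ≥ V(i,j,l)` for every label of weight `w` (Le Gall values
of the components, cubed).  Let `S ⊆ S_{abc}` contain the pair labels of the support of the
component `(t ⊗ t′)(a,b,c)` and let `P` be a probability distribution on `S`.  Then
`V_ρ((t ⊗ t′)(a,b,c))³ ≥ 2^{H(P₁)+H(P₂)+H(P₃) − 3Γ_S(P)} · ∏_{s ∈ S} (V(s₁) V′(s₂))^{P(s)}`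
in Le Gall's sense (`HasLaserValue` of `symm3`): Theorem 4.1 applied to the (tight) pair
decomposition, whose components `t(s₁) ⊗ t′(s₂)` have values `≥ V(s₁) V′(s₂)` by
supermultiplicativity. [cite: LeGall2014, §5 (pp. 9–10) with Thm. 4.1] -/
theorem hasLaserValue_symm3_prodComp (t : X → Y → Z → K) (t' : X' → Y' → Z' → K) {w w' : ℕ}
    {ρ : ℝ}
    (V : Fin (B + 1) × Fin (B + 1) × Fin (B + 1) → ℝ)
    (V' : Fin (B' + 1) × Fin (B' + 1) × Fin (B' + 1) → ℝ) (hV0 : ∀ s, 0 < V s)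
    (hV0' : ∀ s, 0 < V' s)
    (hV : ∀ s, (s.1 : ℕ) + s.2.1 + s.2.2 = w →
      HasLaserValue ρ (symm3 (partSubtensor pX pY pZ t {s.1} {s.2.1} {s.2.2})) (V s))
    (hV' : ∀ s, (s.1 : ℕ) + s.2.1 + s.2.2 = w' →
      HasLaserValue ρ (symm3 (partSubtensor pX' pY' pZ' t' {s.1} {s.2.1} {s.2.2})) (V' s))
    (a b c : Fin (B + B' + 1))
    (S : Finset ((Fin (B + 1) × Fin (B' + 1)) × (Fin (B + 1) × Fin (B' + 1)) ×
      (Fin (B + 1) × Fin (B' + 1))))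
    (hS : ∀ x y z, prodComp pX pY pZ pX' pY' pZ' t t' a b c x y z ≠ 0 →
      (pairLab pX pX' x, pairLab pY pY' y, pairLab pZ pZ' z) ∈ S)
    (hSw : ∀ s ∈ S, s ∈ pairSupp B B' w w' a b c)
    (P : (Fin (B + 1) × Fin (B' + 1)) × (Fin (B + 1) × Fin (B' + 1)) ×
      (Fin (B + 1) × Fin (B' + 1)) → ℝ)
    (hP0 : ∀ s, 0 ≤ P s) (hP1 : ∑ s, P s = 1) (hPS : ∀ s, s ∉ S → P s = 0) :
    HasLaserValue ρ (symm3 (prodComp pX pY pZ pX' pY' pZ' t t' a b c))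
      ((2 : ℝ) ^ (shannonEntropy (marginalDist₁ P) + shannonEntropy (marginalDist₂ P) +
          shannonEntropy (marginalDist₃ P) - 3 * maxEntropyPenalty S P) *
        ∏ s ∈ S, (V (s.1.1, s.2.1.1, s.2.2.1) * V' (s.1.2, s.2.1.2, s.2.2.2)) ^ P s) := by
  classical
  -- the values of the pair components: cube roots of `V(s₁) V′(s₂)`
  set u : (Fin (B + 1) × Fin (B' + 1)) × (Fin (B + 1) × Fin (B' + 1)) ×
      (Fin (B + 1) × Fin (B' + 1)) → ℝ :=
    fun s => (V (s.1.1, s.2.1.1, s.2.2.1) * V' (s.1.2, s.2.1.2, s.2.2.2)) ^ ((1 : ℝ) / 3) with hu_def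
  have hVV : ∀ s : (Fin (B + 1) × Fin (B' + 1)) × (Fin (B + 1) × Fin (B' + 1)) ×
      (Fin (B + 1) × Fin (B' + 1)), 0 < V (s.1.1, s.2.1.1, s.2.2.1) * V' (s.1.2, s.2.1.2, s.2.2.2) :=
    fun s => mul_pos (hV0 _) (hV0' _)
  have hu : ∀ s ∈ S, 0 < u s := fun s _ => Real.rpow_pos_of_pos (hVV s) _
  have hu3 : ∀ s, u s ^ 3 = V (s.1.1, s.2.1.1, s.2.2.1) * V' (s.1.2, s.2.1.2, s.2.2.2) := by
    intro s
    rw [hu_def, ← Real.rpow_natCast, ← Real.rpow_mul (hVV s).le]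
    norm_num
  have hval : ∀ s ∈ S, HasLaserValue ρ (symm3 (partSubtensor (pairLab pX pX') (pairLab pY pY')
      (pairLab pZ pZ') (prodComp pX pY pZ pX' pY' pZ' t t' a b c) {s.1} {s.2.1} {s.2.2}))
      (u s ^ 3) := by
    intro s hs
    have hs' := hSw s hs
    rw [mem_pairSupp] at hs'
    obtain ⟨h1, h2, ha, hb, hc⟩ := hs'
    rw [prodComp_pair, if_pos ⟨Fin.ext (by simp [coe_addLab]; omega),
      Fin.ext (by simp [coe_addLab]; omega), Fin.ext (by simp [coe_addLab]; omega)⟩, hu3]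
    exact (hV (s.1.1, s.2.1.1, s.2.2.1) h1).symm3_kronecker (hV' (s.1.2, s.2.1.2, s.2.2.2) h2)
      (hV0 _).le (hV0' _).le
  have h := laserMethodSym_hasLaserValue (prodComp pX pY pZ pX' pY' pZ' t t' a b c)
    (pairLab pX pX') (pairLab pY pY') (pairLab pZ pZ') S hS pairTight pairTight (pairTightγ w w')
    pairTight_injective pairTight_injective (pairTightγ_injective w w') (pairTight_bound w w')
    (pairTight_bound w w') (pairTightγ_bound w w') (fun s hs k => pairTight_sum s (hSw s hs) k)
    u hu hval P hP0 hP1 hPS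
  have hprod : (∏ s ∈ S, u s ^ P s) ^ 3 =
      ∏ s ∈ S, (V (s.1.1, s.2.1.1, s.2.2.1) * V' (s.1.2, s.2.1.2, s.2.2.2)) ^ P s := by
    rw [← Finset.prod_pow]
    refine Finset.prod_congr rfl fun s _ => ?_
    rw [hu_def, ← Real.rpow_natCast, ← Real.rpow_mul (hVV s).le, ← Real.rpow_mul (hVV s).le]
    congr 1
    push_cast
    ring
  rwa [hprod] at h

end Recursion

/-! ## Components with a zero label: unit slices (Le Gall Lemma 6.1) -/

section UnitSlice

variable {K : Type u} [CommSemiring K]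
variable {X Y Z X' Y' Z' : Type*}

/-- **The `x₀`-slice of `t` is a unit slice**: `t(x₀, y, z) = [y ∈ A ∧ z = φ(y)]` with `φ`
injective on `A` — the slice is `∑_{y ∈ A} x₀ y φ(y) ≅ ⟨1, |A|, 1⟩` (the shape of the components
`t^{⊗2^r}(0, b, c)` of the powers of `CW_q`: "`T_{0JK}` is a matrix product").
[cite: LeGall2014, Lemma 6.1] -/
def IsUnitSlice [DecidableEq Y] [DecidableEq Z] (t : X → Y → Z → K) (x₀ : X)
    (A : Finset Y) (φ : Y → Z) : Prop :=
  Set.InjOn φ A ∧ ∀ y z, t x₀ y z = if y ∈ A ∧ z = φ y then 1 else 0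

/-- **Unit slices multiply**: if the `x₀`-slice of `t` and the `x₀′`-slice of `t′` are unit slices
over `A`, `A′`, the `(x₀,x₀′)`-slice of `t ⊗ t′` is a unit slice over `A × A′`.
[cite: LeGall2014, Lemma 6.1 (proof, via Stothers 2010 Claim 7)] -/
theorem IsUnitSlice.kronecker [DecidableEq Y] [DecidableEq Z] [DecidableEq Y']
    [DecidableEq Z'] {t : X → Y → Z → K} {t' : X' → Y' → Z' → K} {x₀ : X} {A : Finset Y}
    {φ : Y → Z} {x₀' : X'} {A' : Finset Y'} {φ' : Y' → Z'} (h : IsUnitSlice t x₀ A φ)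
    (h' : IsUnitSlice t' x₀' A' φ') :
    IsUnitSlice (kroneckerTensor t t') (x₀, x₀') (A ×ˢ A') (Prod.map φ φ') := by
  refine ⟨?_, fun y z => ?_⟩
  · intro y hy y' hy' he
    simp only [Finset.coe_product, Set.mem_prod, Finset.mem_coe] at hy hy'
    obtain ⟨e1, e2⟩ := Prod.ext_iff.mp he
    exact Prod.ext (h.1 hy.1 hy'.1 e1) (h'.1 hy.2 hy'.2 e2)
  · rw [kroneckerTensor_apply, h.2, h'.2]
    simp only [Finset.mem_product, Prod.ext_iff, Prod.map_fst, Prod.map_snd]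
    by_cases c1 : y.1 ∈ A ∧ z.1 = φ y.1
    · by_cases c2 : y.2 ∈ A' ∧ z.2 = φ' y.2
      · rw [if_pos c1, if_pos c2, if_pos ⟨⟨c1.1, c2.1⟩, c1.2, c2.2⟩, one_mul]
      · rw [if_neg c2, mul_zero, if_neg]
        exact fun H => c2 ⟨H.1.2, H.2.2⟩
    · rw [if_neg c1, zero_mul, if_neg]
      exact fun H => c1 ⟨H.1.1, H.2.1⟩

/-- **Unit slices survive zero-outs keeping `x₀`**: the `x₀`-slice of `T‖_{S_A,S_B,S_C}` is the unit
slice over the `y ∈ A` with `p_Y(y) ∈ S_B` and `p_Z(φ y) ∈ S_C`. [cite: LeGall2014, Lemma 6.1] -/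
theorem IsUnitSlice.partSubtensor [DecidableEq Y] [DecidableEq Z] {PX PY PZ : Type*}
    [DecidableEq PX] [DecidableEq PY] [DecidableEq PZ] {pX : X → PX} {pY : Y → PY} {pZ : Z → PZ}
    {t : X → Y → Z → K} {x₀ : X} {A : Finset Y} {φ : Y → Z} (h : IsUnitSlice t x₀ A φ)
    {SA : Finset PX} (hx : pX x₀ ∈ SA) (SB : Finset PY) (SC : Finset PZ) :
    IsUnitSlice (partSubtensor pX pY pZ t SA SB SC) x₀
      (A.filter fun y => pY y ∈ SB ∧ pZ (φ y) ∈ SC) φ := by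
  refine ⟨h.1.mono (fun y hy => ?_), fun y z => ?_⟩
  · simp only [Finset.coe_filter, Set.mem_setOf_eq] at hy
    exact hy.1
  · rw [partSubtensor_apply, h.2]
    simp only [Finset.mem_filter, hx, true_and]
    by_cases hz : z = φ y
    · subst hz
      by_cases hy : y ∈ A
      · by_cases hc : pY y ∈ SB ∧ pZ (φ y) ∈ SC
        · simp [hy, hc]
        · simp [hy, hc]
      · simp [hy]
    · simp [hz]

variable [Fintype X] [Fintype Y] [Fintype Z] [DecidableEq X] [DecidableEq Y] [DecidableEq Z]

/-- **A tensor with a unit slice over `A` restricts to `⟨1, |A|, 1⟩`.** [cite: LeGall2014, Lemma 6.1] -/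
theorem IsUnitSlice.tensorRestrictsTo_matMulTensor {t : X → Y → Z → K} {x₀ : X}
    {A : Finset Y} {φ : Y → Z} (h : IsUnitSlice t x₀ A φ) :
    TensorRestrictsTo t (matMulTensor K 1 A.card 1) := by
  refine tensorRestrictsTo_matMulTensor_mid t x₀ (fun β => (A.equivFin.symm β : Y))
    (fun β => φ (A.equivFin.symm β)) fun β β' => ?_
  rw [h.2]
  have hmem : ((A.equivFin.symm β : A) : Y) ∈ A := (A.equivFin.symm β).2
  by_cases e : β = β'
  · subst e
    simp [hmem]
  · rw [if_neg, if_neg e]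
    rintro ⟨-, he⟩
    apply e
    have h1 : (A.equivFin.symm β' : Y) = A.equivFin.symm β := h.1 (A.equivFin.symm β').2 hmem he
    exact (A.equivFin.symm.injective (Subtype.ext h1)).symm

end UnitSlice

section UnitSliceValue

variable {K : Type u} [Field K]
variable {X Y Z : Type*} [Fintype X] [Fintype Y] [Fintype Z] [DecidableEq X] [DecidableEq Y]
  [DecidableEq Z]

/-- **A tensor with a unit slice over `A` has Le Gall value `≥ |A|^{ρ/3}`** (cubed form).
[cite: LeGall2014, Lemma 6.1] -/
theorem IsUnitSlice.hasLaserValue_symm3 {t : X → Y → Z → K} {x₀ : X} {A : Finset Y}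
    {φ : Y → Z} (h : IsUnitSlice t x₀ A φ) (ρ : ℝ) :
    HasLaserValue ρ (symm3 t) ((((A.card : ℕ) : ℝ) ^ (ρ / 3)) ^ 3) := by
  have h1 := hasLaserValue_symm3_of_restrictsTo_matMulTensor ρ h.tensorRestrictsTo_matMulTensor
  rwa [one_mul, mul_one] at h1

end UnitSliceValue

/-! ## Counting indices of a given sum label -/

section Count

variable {X X' : Type*} [Fintype X] [Fintype X']

/-- **The number of indices of `t ⊗ t′` with sum label `n`** is the convolution
`∑_{i ≤ n} |{g = i}| · |{g′ = n − i}|` of the label counts of the factors (the recursion behind the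
polynomials in `q` of Le Gall's Lemma 6.1 / Stothers' Claim 7). [cite: LeGall2014, Lemma 6.1] -/
theorem card_filter_add_eq_sum (g : X → ℕ) (g' : X' → ℕ) (n : ℕ) :
    (Finset.univ.filter fun x : X × X' => g x.1 + g' x.2 = n).card =
      ∑ i ∈ Finset.range (n + 1), (Finset.univ.filter fun x => g x = i).card *
        (Finset.univ.filter fun x' => g' x' = n - i).card := by
  rw [Finset.card_eq_sum_card_fiberwise (f := fun x : X × X' => g x.1) (t := Finset.range (n + 1))
    (fun x hx => by
      simp only [Finset.coe_filter, Finset.mem_univ, true_and, Set.mem_setOf_eq] at hx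
      simp only [Finset.coe_range, Set.mem_Iio]
      omega)]
  refine Finset.sum_congr rfl fun i hi => ?_
  rw [← Finset.card_product]
  congr 1
  ext ⟨x, x'⟩
  simp only [Finset.mem_filter, Finset.mem_univ, true_and, Finset.mem_product]
  simp only [Finset.mem_range] at hi
  omega

end Count

end Literature.Computability.AlgebraicComplexity
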